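import Mathlib
import HarnessLib
import Literature.Analysis.FluidPDE.SuitableWeak

/-!
# Quantum accounting over dyadic parabolic bands (line dissipation-quantum-tolerance,
# crux ApexLocalisation, stub `stub_quantumAccounting`)

`stub_quantumAccounting` (pure measure theory over the scaled dissipation `cknE`). Write
`F z := ENNReal.ofReal (frobeniusNormSq (G z.1 z.2))` (an arbitrary `ℝ≥0∞`-valued function, no
measurability is used) and `B(ρ, b) := Q((−ρ²/4, b), ρ/2) = (−ρ²/2, −ρ²/4) × B_{ρ/2}(b)` for the
parabolic band of scale `ρ` at `b`.

(a) If `∫_{B(ρ,0)} F ≥ e ρ` for every `ρ > 0`, then `E(Q((0,0),R)) ≥ 2e` for every `R > 0`: the dyadic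
bands `B(R/2^n, 0)`, `n : ℕ`, are pairwise disjoint (scales differing by a factor `≥ 2` have disjoint
time windows, `disjoint_parabolicBand_of_two_mul_le`) measurable subsets of `Q((0,0),R)`
(`parabolicBand_subset_cylinder`), so `∫_Q F ≥ Σ_n e R/2^n = 2 e R` (`lintegral_iUnion`, geometric
series `tsum_ofReal_mul_div_two_pow`), and dividing by `R` gives the claim (`ofReal_le_inv_ofReal_mul`).

(b) If moreover `∫_{B(ρ,b)} F ≥ e ρ` for every `ρ > 0` at a companion `‖b‖ = s > 0`, then
`E(Q((0,0),2s)) ≥ (9/4) e`: the mother bands `B(2s/2^n, 0)` pay `4 e s`, the companion bands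
`B(2s/2^(k+3), b)` (scales `≤ s/4`) pay `e s/2`; all lie in `Q((0,0),2s)` and are pairwise disjoint
(different scales: disjoint time windows; equal scale `ρ ≤ s/4`: disjoint balls, since
`ρ/2 + ρ/2 ≤ s = dist 0 b`, `disjoint_parabolicBand_of_dist`). Total `(9/2) e s = (9/4) e · 2s`.

[folklore]
-/

set_option linter.dupNamespace false

namespace Summit.NavierStokesRegularity.NavierStokesRegularity.Theorems.RellichScarApexLocalisation

open MeasureTheory Set Function Metric Filter Topology TopologicalSpace
open scoped ENNReal NNReal
open Literature.Analysis Literature.Analysis.FluidPDE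

local notation "E³" => EuclideanSpace ℝ (Fin 3)

/-! ### Abstract measure theory and `ℝ≥0∞` arithmetic -/

/-- **Summing lower bounds over disjoint pieces.** If `a i ≤ ∫⁻_{S i} F` for a countable family of
pairwise disjoint measurable sets `S i`, then `∑ a i ≤ ∫⁻_{⋃ S i} F` (no measurability of `F`). -/
theorem tsum_le_lintegral_iUnion_of_le {α ι : Type*} [MeasurableSpace α] [Countable ι]
    {μ : Measure α} {S : ι → Set α} (hS : ∀ i, MeasurableSet (S i))
    (hd : Pairwise (Disjoint on S)) (F : α → ℝ≥0∞) {a : ι → ℝ≥0∞}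
    (ha : ∀ i, a i ≤ ∫⁻ x in S i, F x ∂μ) :
    ∑' i, a i ≤ ∫⁻ x in ⋃ i, S i, F x ∂μ := by
  rw [lintegral_iUnion hS hd]
  exact ENNReal.tsum_le_tsum ha

/-- **Dividing by the scale.** If `ofReal (c r) ≤ I` with `r > 0` then `ofReal c ≤ (ofReal r)⁻¹ I`. -/
theorem ofReal_le_inv_ofReal_mul {c r : ℝ} (hr : 0 < r) {I : ℝ≥0∞}
    (h : ENNReal.ofReal (c * r) ≤ I) : ENNReal.ofReal c ≤ (ENNReal.ofReal r)⁻¹ * I := by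
  have h0 : ENNReal.ofReal r ≠ 0 := (ENNReal.ofReal_pos.2 hr).ne'
  calc ENNReal.ofReal c = (ENNReal.ofReal r)⁻¹ * ENNReal.ofReal (c * r) := by
        rw [ENNReal.ofReal_mul' hr.le, mul_comm (ENNReal.ofReal c), ← mul_assoc,
          ENNReal.inv_mul_cancel h0 ENNReal.ofReal_ne_top, one_mul]
    _ ≤ (ENNReal.ofReal r)⁻¹ * I := mul_le_mul_right h _

/-- **Dyadic scales are separated.** For `n < m`, `2 · c/2^m ≤ c/2^n` (`c ≥ 0`). -/
theorem two_mul_div_two_pow_le {c : ℝ} (hc : 0 ≤ c) {n m : ℕ} (h : n < m) :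
    2 * (c / 2 ^ m) ≤ c / 2 ^ n := by
  have h2 : (2 : ℝ) ^ (n + 1) ≤ 2 ^ m := pow_le_pow_right₀ (by norm_num) (Nat.succ_le_of_lt h)
  have h3 : c / 2 ^ m ≤ c / 2 ^ (n + 1) := div_le_div_of_nonneg_left hc (by positivity) h2
  calc 2 * (c / 2 ^ m) ≤ 2 * (c / 2 ^ (n + 1)) := by linarith
    _ = c / 2 ^ n := by rw [pow_succ]; field_simp

/-- **Geometric series of quanta.** `Σ_n ofReal (e · c/2^n) = ofReal (2 e c)` for `e, c ≥ 0`. -/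
theorem tsum_ofReal_mul_div_two_pow {e c : ℝ} (he : 0 ≤ e) (hc : 0 ≤ c) :
    ∑' n : ℕ, ENNReal.ofReal (e * (c / 2 ^ n)) = ENNReal.ofReal (2 * e * c) := by
  have h : ∀ n : ℕ, ENNReal.ofReal (e * (c / 2 ^ n)) = ENNReal.ofReal (e * c) * 2⁻¹ ^ n := by
    intro n
    rw [mul_div_assoc', div_eq_mul_inv, ENNReal.ofReal_mul (mul_nonneg he hc), ← inv_pow,
      ENNReal.ofReal_pow (by norm_num), ENNReal.ofReal_inv_of_pos (by norm_num),
      ENNReal.ofReal_ofNat]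
  calc ∑' n : ℕ, ENNReal.ofReal (e * (c / 2 ^ n))
        = ∑' n : ℕ, ENNReal.ofReal (e * c) * 2⁻¹ ^ n := tsum_congr h
    _ = ENNReal.ofReal (e * c) * 2 := by
        rw [ENNReal.tsum_mul_left, ENNReal.tsum_geometric, ENNReal.one_sub_inv_two, inv_inv]
    _ = ENNReal.ofReal (2 * e * c) := by
        rw [mul_assoc 2, ENNReal.ofReal_mul (by norm_num : (0 : ℝ) ≤ 2), ENNReal.ofReal_ofNat,
          mul_comm]

/-! ### Geometry of the parabolic bands `B(ρ, x) = Q((−ρ²/4, x), ρ/2)` -/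

/-- **Different scales: disjoint time windows.** If `0 < ρ'` and `2ρ' ≤ ρ`, the bands
`B(ρ, x) = (−ρ²/2, −ρ²/4) × B_{ρ/2}(x)` and `B(ρ', y)` are disjoint: `−ρ'²/2 ≥ −ρ²/8 > −ρ²/4`. -/
theorem disjoint_parabolicBand_of_two_mul_le {ρ ρ' : ℝ} (hρ' : 0 < ρ') (h : 2 * ρ' ≤ ρ)
    (x y : E³) :
    Disjoint (parabolicCylinder (ρ / 2) ((-(ρ ^ 2 / 4) : ℝ), x))
      (parabolicCylinder (ρ' / 2) ((-(ρ' ^ 2 / 4) : ℝ), y)) := by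
  refine Set.disjoint_left.2 fun w hw hw' => ?_
  simp only [mem_parabolicCylinder] at hw hw'
  have key : 4 * ρ' ^ 2 ≤ ρ ^ 2 := by nlinarith
  nlinarith [hw.1.2, hw'.1.1, sq_nonneg ρ']

/-- **Equal (or any) scales, far-apart centres: disjoint balls.** If `ρ/2 + ρ'/2 ≤ dist x y`, the
cylinders `Q((t, x), ρ/2)` and `Q((t', y), ρ'/2)` are disjoint. -/
theorem disjoint_parabolicBand_of_dist {ρ ρ' : ℝ} {x y : E³} (h : ρ / 2 + ρ' / 2 ≤ dist x y)
    (t t' : ℝ) :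
    Disjoint (parabolicCylinder (ρ / 2) (t, x)) (parabolicCylinder (ρ' / 2) (t', y)) :=
  Set.disjoint_prod.2 (Or.inr (ball_disjoint_ball h))

/-- **Dyadic bands of distinct indices are disjoint** (any centres): the scales `c/2^n`, `c/2^m`,
`n ≠ m`, differ by a factor `≥ 2`. -/
theorem disjoint_dyadicBand_of_ne {c : ℝ} (hc : 0 < c) (x y : E³) {n m : ℕ} (hnm : n ≠ m) :
    Disjoint (parabolicCylinder (c / 2 ^ n / 2) ((-((c / 2 ^ n) ^ 2 / 4) : ℝ), x))
      (parabolicCylinder (c / 2 ^ m / 2) ((-((c / 2 ^ m) ^ 2 / 4) : ℝ), y)) := by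
  rcases lt_or_gt_of_ne hnm with h | h
  · exact disjoint_parabolicBand_of_two_mul_le (by positivity) (two_mul_div_two_pow_le hc.le h) x y
  · exact (disjoint_parabolicBand_of_two_mul_le (by positivity)
      (two_mul_div_two_pow_le hc.le h) y x).symm

/-- **Bands inside the big cylinder.** If `0 < ρ ≤ R` and `‖x‖ + ρ/2 ≤ R`, then
`B(ρ, x) ⊆ Q((0, 0), R) = (−R², 0) × B_R(0)`. -/
theorem parabolicBand_subset_cylinder {ρ R : ℝ} {x : E³} (hρ : 0 < ρ) (hρR : ρ ≤ R)
    (hx : ‖x‖ + ρ / 2 ≤ R) :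
    parabolicCylinder (ρ / 2) ((-(ρ ^ 2 / 4) : ℝ), x) ⊆
      parabolicCylinder R ((0 : ℝ), (0 : E³)) := by
  intro w hw
  simp only [mem_parabolicCylinder] at hw ⊢
  have hρρ : ρ * ρ ≤ R * R := mul_le_mul hρR hρR hρ.le (hρ.le.trans hρR)
  refine ⟨⟨by nlinarith [hw.1.1, mul_pos hρ hρ], by nlinarith [hw.1.2, sq_nonneg ρ]⟩, ?_⟩
  calc dist w.2 0 ≤ dist w.2 x + dist x 0 := dist_triangle _ _ _
    _ < R := by rw [dist_zero_right]; linarith [hw.2]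

/-! ### The two accounting statements -/

/-- **(a) Mother accounting.** Quanta `e ρ` in all bands `B(ρ, 0)` force `E(Q((0,0),R)) ≥ 2e`:
the dyadic bands `B(R/2^n, 0)` are pairwise disjoint inside `Q((0,0),R)` and pay
`Σ_n e R/2^n = 2 e R`. -/
theorem quantumAccounting_mother (G : ℝ → E³ → E³ →L[ℝ] E³) (e : ℝ) (he : 0 ≤ e)
    (h : ∀ ρ : ℝ, 0 < ρ → ENNReal.ofReal (e * ρ) ≤
      ∫⁻ z in parabolicCylinder (ρ / 2) ((-(ρ ^ 2 / 4) : ℝ), (0 : E³)),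
        ENNReal.ofReal (frobeniusNormSq (G z.1 z.2)))
    (R : ℝ) (hR : 0 < R) : ENNReal.ofReal (2 * e) ≤ cknE R ((0 : ℝ), (0 : E³)) G := by
  unfold cknE
  refine ofReal_le_inv_ofReal_mul hR ?_
  rw [← tsum_ofReal_mul_div_two_pow he hR.le]
  calc ∑' n : ℕ, ENNReal.ofReal (e * (R / 2 ^ n))
        ≤ ∫⁻ z in ⋃ n : ℕ, parabolicCylinder (R / 2 ^ n / 2) ((-((R / 2 ^ n) ^ 2 / 4) : ℝ), (0 : E³)),
            ENNReal.ofReal (frobeniusNormSq (G z.1 z.2)) :=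
          tsum_le_lintegral_iUnion_of_le (fun n => (isOpen_parabolicCylinder _ _).measurableSet)
            (fun n m hnm => disjoint_dyadicBand_of_ne hR 0 0 hnm) _
            (fun n => h _ (by positivity))
    _ ≤ ∫⁻ z in parabolicCylinder R ((0 : ℝ), (0 : E³)),
          ENNReal.ofReal (frobeniusNormSq (G z.1 z.2)) := by
          refine lintegral_mono_set (iUnion_subset fun n => ?_)
          have h1 : R / 2 ^ n ≤ R := div_le_self hR.le (one_le_pow₀ (by norm_num))
          exact parabolicBand_subset_cylinder (by positivity) h1 (by rw [norm_zero]; linarith)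

/-- **(b) Mother + companion accounting.** Quanta `e ρ` in all bands `B(ρ, 0)` and `B(ρ, b)`,
`‖b‖ = s > 0`, force `E(Q((0,0),2s)) ≥ (9/4) e`: mother bands `B(2s/2^n, 0)` pay `4 e s`, companion
bands `B(2s/2^(k+3), b)` pay `e s/2`, all pairwise disjoint inside `Q((0,0),2s)`. -/
theorem quantumAccounting_companion (G : ℝ → E³ → E³ →L[ℝ] E³) (e s : ℝ) (b : E³) (he : 0 ≤ e)
    (hs : 0 < s) (hb : ‖b‖ = s)
    (h0 : ∀ ρ : ℝ, 0 < ρ → ENNReal.ofReal (e * ρ) ≤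
      ∫⁻ z in parabolicCylinder (ρ / 2) ((-(ρ ^ 2 / 4) : ℝ), (0 : E³)),
        ENNReal.ofReal (frobeniusNormSq (G z.1 z.2)))
    (hb' : ∀ ρ : ℝ, 0 < ρ → ENNReal.ofReal (e * ρ) ≤
      ∫⁻ z in parabolicCylinder (ρ / 2) ((-(ρ ^ 2 / 4) : ℝ), b),
        ENNReal.ofReal (frobeniusNormSq (G z.1 z.2))) :
    ENNReal.ofReal (9 / 4 * e) ≤ cknE (2 * s) ((0 : ℝ), (0 : E³)) G := by
  unfold cknE
  have hc : 0 < 2 * s := by positivity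
  refine ofReal_le_inv_ofReal_mul hc ?_
  -- the integrand, the mother bands `M n` and the companion bands `N k`
  set F : ℝ × E³ → ℝ≥0∞ := fun z => ENNReal.ofReal (frobeniusNormSq (G z.1 z.2)) with hF
  set M : ℕ → Set (ℝ × E³) := fun n =>
    parabolicCylinder (2 * s / 2 ^ n / 2) ((-((2 * s / 2 ^ n) ^ 2 / 4) : ℝ), (0 : E³)) with hM
  set N : ℕ → Set (ℝ × E³) := fun k =>
    parabolicCylinder (2 * s / 2 ^ (k + 3) / 2) ((-((2 * s / 2 ^ (k + 3)) ^ 2 / 4) : ℝ), b)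
    with hN
  -- scale facts
  have hσle : ∀ n : ℕ, 2 * s / 2 ^ n ≤ 2 * s := fun n =>
    div_le_self hc.le (one_le_pow₀ (by norm_num))
  have hσ3 : ∀ k : ℕ, 2 * s / 2 ^ (k + 3) ≤ s / 4 := by
    intro k
    have h8 : (2 : ℝ) ^ 3 ≤ 2 ^ (k + 3) := pow_le_pow_right₀ (by norm_num) (by omega)
    calc 2 * s / 2 ^ (k + 3) ≤ 2 * s / 2 ^ 3 := div_le_div_of_nonneg_left hc.le (by norm_num) h8
      _ = s / 4 := by norm_num; ring
  -- measurability, disjointness, inclusion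
  have hMm : ∀ n, MeasurableSet (M n) := fun n => (isOpen_parabolicCylinder _ _).measurableSet
  have hNm : ∀ k, MeasurableSet (N k) := fun k => (isOpen_parabolicCylinder _ _).measurableSet
  have hMd : Pairwise (Disjoint on M) := fun n m hnm => disjoint_dyadicBand_of_ne hc 0 0 hnm
  have hNd : Pairwise (Disjoint on N) := fun k k' hkk' =>
    disjoint_dyadicBand_of_ne hc b b (by omega : k + 3 ≠ k' + 3)
  have hMN : Disjoint (⋃ n, M n) (⋃ k, N k) := by
    refine disjoint_iUnion_left.2 fun n => disjoint_iUnion_right.2 fun k => ?_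
    by_cases hnk : n = k + 3
    · subst hnk
      refine disjoint_parabolicBand_of_dist ?_ _ _
      rw [add_halves, dist_comm, dist_zero_right, hb]
      linarith [hσ3 k]
    · exact disjoint_dyadicBand_of_ne hc 0 b hnk
  have hMQ : (⋃ n, M n) ⊆ parabolicCylinder (2 * s) ((0 : ℝ), (0 : E³)) :=
    iUnion_subset fun n => parabolicBand_subset_cylinder (by positivity) (hσle n)
      (by rw [norm_zero]; linarith [hσle n, (by positivity : 0 < 2 * s / 2 ^ n)])
  have hNQ : (⋃ k, N k) ⊆ parabolicCylinder (2 * s) ((0 : ℝ), (0 : E³)) :=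
    iUnion_subset fun k => parabolicBand_subset_cylinder (by positivity)
      ((hσ3 k).trans (by linarith)) (by rw [hb]; linarith [hσ3 k])
  -- the two sums of quanta
  have h1 : ∑' n : ℕ, ENNReal.ofReal (e * (2 * s / 2 ^ n)) ≤ ∫⁻ z in ⋃ n, M n, F z :=
    tsum_le_lintegral_iUnion_of_le hMm hMd F fun n => h0 _ (by positivity)
  have h2 : ∑' k : ℕ, ENNReal.ofReal (e * (2 * s / 2 ^ (k + 3))) ≤ ∫⁻ z in ⋃ k, N k, F z :=
    tsum_le_lintegral_iUnion_of_le hNm hNd F fun k => hb' _ (by positivity)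
  have hsum1 : ∑' n : ℕ, ENNReal.ofReal (e * (2 * s / 2 ^ n)) = ENNReal.ofReal (2 * e * (2 * s)) :=
    tsum_ofReal_mul_div_two_pow he hc.le
  have hsum2 : ∑' k : ℕ, ENNReal.ofReal (e * (2 * s / 2 ^ (k + 3))) =
      ENNReal.ofReal (2 * e * (s / 4)) := by
    have h' : ∀ k : ℕ, 2 * s / 2 ^ (k + 3) = s / 4 / 2 ^ k := fun k => by
      rw [pow_add]; field_simp; ring
    simp_rw [h']
    exact tsum_ofReal_mul_div_two_pow he (by positivity)
  calc ENNReal.ofReal (9 / 4 * e * (2 * s))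
        = ENNReal.ofReal (2 * e * (2 * s)) + ENNReal.ofReal (2 * e * (s / 4)) := by
          rw [← ENNReal.ofReal_add (by positivity) (by positivity)]
          congr 1
          ring
    _ ≤ (∫⁻ z in ⋃ n, M n, F z) + ∫⁻ z in ⋃ k, N k, F z := by
          rw [← hsum1, ← hsum2]
          exact add_le_add h1 h2
    _ = ∫⁻ z in (⋃ n, M n) ∪ ⋃ k, N k, F z :=
          (lintegral_union (MeasurableSet.iUnion hNm) hMN).symm
    _ ≤ ∫⁻ z in parabolicCylinder (2 * s) ((0 : ℝ), (0 : E³)), F z :=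
          lintegral_mono_set (union_subset hMQ hNQ)

/-- **S4, QUANTUM ACCOUNTING** (the card's tolerance arithmetic, pure measure theory over `cknE`):
(a) if a gradient field pays `e ρ` in every band `Q((−ρ²/4,0),ρ/2)`, `ρ > 0`, then
`E(Q((0,0),R)) ≥ 2e` for every `R > 0` (the dyadic bands `ρ = R 2^{-j}`, `j ≥ 0`, are pairwise disjoint
inside `Q((0,0),R)` and pay `e R Σ 2^{-j} = 2 e R`); (b) if moreover it pays `e ρ` in every band
`Q((−ρ²/4,b),ρ/2)` of a companion `‖b‖ = s > 0`, then `E(Q((0,0),2s)) ≥ (9/4) e` (the companion bands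
`ρ = s 2^{-i}`, `i ≥ 2`, are disjoint from the mother's and from each other inside `Q((0,0),2s)`:
total `4 e s + e s/2`). [folklore] -/
theorem stub_quantumAccounting :
    (∀ (G : ℝ → E³ → E³ →L[ℝ] E³) (e : ℝ), 0 ≤ e →
      (∀ ρ : ℝ, 0 < ρ → ENNReal.ofReal (e * ρ) ≤
        ∫⁻ z in parabolicCylinder (ρ / 2) ((-(ρ ^ 2 / 4) : ℝ), (0 : E³)),
          ENNReal.ofReal (frobeniusNormSq (G z.1 z.2))) →
      ∀ R : ℝ, 0 < R → ENNReal.ofReal (2 * e) ≤ cknE R ((0 : ℝ), (0 : E³)) G) ∧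
    (∀ (G : ℝ → E³ → E³ →L[ℝ] E³) (e s : ℝ) (b : E³), 0 ≤ e → 0 < s → ‖b‖ = s →
      (∀ ρ : ℝ, 0 < ρ → ENNReal.ofReal (e * ρ) ≤
        ∫⁻ z in parabolicCylinder (ρ / 2) ((-(ρ ^ 2 / 4) : ℝ), (0 : E³)),
          ENNReal.ofReal (frobeniusNormSq (G z.1 z.2))) →
      (∀ ρ : ℝ, 0 < ρ → ENNReal.ofReal (e * ρ) ≤
        ∫⁻ z in parabolicCylinder (ρ / 2) ((-(ρ ^ 2 / 4) : ℝ), b),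
          ENNReal.ofReal (frobeniusNormSq (G z.1 z.2))) →
      ENNReal.ofReal (9 / 4 * e) ≤ cknE (2 * s) ((0 : ℝ), (0 : E³)) G) :=
  ⟨quantumAccounting_mother, quantumAccounting_companion⟩

end Summit.NavierStokesRegularity.NavierStokesRegularity.Theorems.RellichScarApexLocalisation
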